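import Literature.IUT.LogVolume.GenuineLogTheta
import Literature.IUT.LogVolume.RescaledCompletionInvariants
import HarnessLib

/-!
# The ideles of a genuine Θ-volume input EXIST: `ThetaVolumeInput F₀ K` is inhabited over `(X, σ)` as soon as the
# valuation of `q̲_v = q_v^{1/2l}` is attained in `K_{v̲}` (proof-only companion of `GenuineLogTheta.lean`)

Mochizuki, *Inter-universal Teichmüller theory I*, Example 3.2 (iv) (kurims May-2020 manuscript p. 71: "`q̲_v :=`
a `2l`-th root of the `q`-parameter `q_v`", an element of `K_{v̲}` for `v̲ ∈ V̲^bad`); Dupuy–Hilado,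
arXiv:2004.13228 §3.9 ("let `a = (a_{v̲}) ∈ 𝔸_{V̲}` be such that `D = div(a)`"). abc-iut cell, campaign-S /
D9′ main line, seat abc-iut-w4-d037 (wave 4).

`GenuineLogTheta.lean` (abc-iut-S2, route request `defn-NegLogThetaAtDatum`) defines `−|log(Θ)|` for a
`ThetaVolumeInput F₀ K`: pilot data `X`, a section `σ` of finite places, and IDELES `t_Θ`, `t_q` — units of the
GENUINE completions `K_{v̲}` (`σ.localFields p`, abc-iut-S7's `RescaledCompletion`) with prescribed
`F₀`-normalised valuations `ord_v(t_{Θ,j,v}) = j²·ord_v(q_v)/(2l)`, `ord_v(t_{q,v}) = ord_v(q_v)/(2l)` on `S` and `0`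
off `S`; its docstring records the ideles as "INPUT, not constructed" ("Deliberately NOT here: … the existence of
ideles"), and `CompletionLocalFields.lean` likewise ("the ideles realising the pilot divisors in `K_{v̲}`").
THIS FILE CONSTRUCTS them (existentially, no new definitions):

* `RescaledCompletion.exists_units_norm_eq_rpow` — for every `n : ℤ` a unit `a ∈ K_{v̲}^×` with
  `‖a‖ = p^{n/e(v̲|p)}` (powers of abc-iut-S7's norm uniformizer `exists_isUniformizer_rescaledCompletion`);
* `PlaceSection.exists_units_ordv_eq` — hence `ord_v(a) = n·e_v/e_{v̲}` is attained for every `n : ℤ`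
  (`e_v = ramIdx F₀ v`, `e_{v̲} = (σ.lift v).asIdeal.ramificationIdx ℤ`): the value group of c312-3's
  `LocalFields.ordv` on `K_{v̲}^×` contains `(e_v/e_{v̲})·ℤ` (`= (1/e(v̲|v))·ℤ`);
* `PilotData.thetaPilot_apply_of_mem` / `_of_not_mem`, `qPilot_apply_of_mem` / `_of_not_mem` — the coefficients of
  the pilot divisors read off (`j²·ord_v(q_v)/(2l)`, `ord_v(q_v)/(2l)` on `S`; `0` off `S`);
* **`ThetaVolumeInput.exists_of_ordq`** — if for every `v ∈ S` the rational number `ord_v(q_v)/(2l)` lies in that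
  value group (`∃ n : ℤ, n·e_v/e_{v̲} = ord_v(q_v)/(2l)`: the VALUATION of `q̲_v = q_v^{1/2l}` is attained in `K_{v̲}`,
  as it is for initial Θ-data, where `q̲_v ∈ K_{v̲}` itself), then `∃ I : ThetaVolumeInput F₀ K` with `I.X = X`,
  `I.σ = σ`. No `2l`-th ROOT of `q_v` is needed for the log-volume computations of [IUTchIII] Cor. 3.12 /
  Dupuy–Hilado (1.1) — only its valuation; the "Tate-uniformisation-grade input" of `GenuineLogTheta.lean` thus
  reduces to one divisibility condition on ramification indices.

Classical throughout (uniformizers of `p`-adic fields); nothing here bears on the disputed [IUTchIII] Cor. 3.12,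
and no instance is an endorsement. [cite: Mochizuki2012, IUTchI Ex. 3.2 (iv) p. 71]
[cite: DupuyHilado2025, §3.9] [cite: NeukirchANT1999, Ch. II Prop. (6.8)]
-/

noncomputable section

namespace Literature.IUT.LogVolume

open NumberField IsDedekindDomain Literature.NumberTheory.NumberFields

/-! ## Units of prescribed norm / valuation in the genuine completions -/

section Units

variable (K : Type) [Field K] [NumberField K] (p : ℕ) [Fact p.Prime] (w : HeightOneSpectrum (𝓞 K))
  (hw : ((p : ℕ) : 𝓞 K) ∈ w.asIdeal)

/-- For every `n : ℤ` there is a unit `a ∈ K_{v̲}^×` of the rescaled completion with `‖a‖ = p^{−n/e(v̲|p)}`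
(the `n`-th power of a norm uniformizer, abc-iut-S7's `exists_isUniformizer_rescaledCompletion`).
[cite: NeukirchANT1999, Ch. II Prop. (6.8)] -/
theorem RescaledCompletion.exists_units_norm_eq_rpow (n : ℤ) :
    ∃ a : (RescaledCompletion K p w hw)ˣ,
      ‖(a : RescaledCompletion K p w hw)‖ = (p : ℝ) ^ (-(n : ℝ) / (w.asIdeal.ramificationIdx ℤ : ℝ)) := by
  obtain ⟨ϖ, -, hϖ⟩ := exists_isUniformizer_rescaledCompletion K p w hw
  refine ⟨ϖ ^ n, ?_⟩
  have hp : (0 : ℝ) ≤ (p : ℝ) := Nat.cast_nonneg p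
  rw [Units.val_zpow_eq_zpow_val, norm_zpow, hϖ, ← Real.rpow_intCast, ← Real.rpow_mul hp]
  congr 1
  ring

/-- The logarithm of that norm: `log ‖a‖ = −(n/e(v̲|p))·log p`. [cite: NeukirchANT1999, Ch. II Prop. (6.8)] -/
theorem RescaledCompletion.exists_units_log_norm_eq (n : ℤ) :
    ∃ a : (RescaledCompletion K p w hw)ˣ,
      Real.log ‖(a : RescaledCompletion K p w hw)‖ =
        -(n : ℝ) / (w.asIdeal.ramificationIdx ℤ : ℝ) * Real.log p := by
  obtain ⟨a, ha⟩ := RescaledCompletion.exists_units_norm_eq_rpow K p w hw n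
  refine ⟨a, ?_⟩
  have hp : (0 : ℝ) < (p : ℝ) := by exact_mod_cast (Fact.out : p.Prime).pos
  rw [ha, Real.log_rpow hp]

end Units

/-! ## The value group of `ord_v` on `K_{v̲}^×` -/

section Ordv

variable {F₀ : Type} [Field F₀] [NumberField F₀] {K : Type} [Field K] [NumberField K] [Algebra F₀ K]
variable (σ : PlaceSection F₀ K)

/-- For every `n : ℤ` there is a unit `a ∈ K_{v̲}^×` of the genuine completion at `v̲ = σ.lift v` with
`F₀`-normalised valuation `ord_v(a) = n·e_v/e_{v̲}` (c312-3's `LocalFields.ordv`: `ord_v(a) = −e_v·log‖a‖/log p`;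
`e_v = e(v|p)`, `e_{v̲} = e(v̲|p)`, so `e_v/e_{v̲} = 1/e(v̲|v)` — Dupuy–Hilado §2.4.2 "`ord_L = e(L/K)·ord_K`").
[cite: DupuyHilado2025, §2.4.2, §3.4] -/
theorem PlaceSection.exists_units_ordv_eq (p : ℕ) [Fact p.Prime] (v : placesOver F₀ p) (n : ℤ) :
    ∃ a : ((σ.localFields p).k v)ˣ,
      (σ.localFields p).ordv a =
        (n : ℝ) * (ramIdx F₀ v.1 : ℝ) / ((σ.lift v.1).asIdeal.ramificationIdx ℤ : ℝ) := by
  obtain ⟨a, ha⟩ :=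
    RescaledCompletion.exists_units_log_norm_eq K p (σ.lift v.1) (σ.natCast_mem_lift v) n
  refine ⟨a, ?_⟩
  have hp : Real.log p ≠ 0 := by
    have h1 : (1 : ℝ) < p := by exact_mod_cast (Fact.out : p.Prime).one_lt
    exact (Real.log_pos h1).ne'
  rw [LocalFields.ordv]
  erw [ha]
  field_simp

end Ordv

/-! ## The coefficients of the pilot divisors -/

namespace PilotData

variable {F : Type} [Field F] [NumberField F] (X : PilotData F)

/-- The coefficient of `P_{Θ,j}` at `v ∈ S` is `j²·ord_v(q_v)/(2l)` (`j = i+1`). [cite: DupuyHilado2025, §3.3] -/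
theorem thetaPilot_apply_of_mem (i : Fin X.lstar) {v : HeightOneSpectrum (𝓞 F)} (hv : v ∈ X.S) :
    X.thetaPilot i v = (((i : ℕ) + 1 : ℝ) ^ 2) * (X.ordq v : ℝ) / (2 * X.l) := by
  classical
  simp only [thetaPilot, FinDivisor.of, Finsupp.finsetSum_apply, Finsupp.single_apply,
    Finset.sum_ite_eq', if_pos hv]

/-- Off `S` the coefficient of `P_{Θ,j}` is `0`. [cite: DupuyHilado2025, §3.3] -/
theorem thetaPilot_apply_of_not_mem (i : Fin X.lstar) {v : HeightOneSpectrum (𝓞 F)} (hv : v ∉ X.S) :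
    X.thetaPilot i v = 0 := by
  classical
  simp only [thetaPilot, FinDivisor.of, Finsupp.finsetSum_apply, Finsupp.single_apply,
    Finset.sum_ite_eq', if_neg hv]

/-- The coefficient of `P_q` at `v ∈ S` is `ord_v(q_v)/(2l)`. [cite: DupuyHilado2025, §3.3] -/
theorem qPilot_apply_of_mem {v : HeightOneSpectrum (𝓞 F)} (hv : v ∈ X.S) :
    X.qPilot v = (X.ordq v : ℝ) / (2 * X.l) := by
  classical
  simp only [qPilot, FinDivisor.of, Finsupp.finsetSum_apply, Finsupp.single_apply, Finset.sum_ite_eq',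
    if_pos hv]

/-- Off `S` the coefficient of `P_q` is `0`. [cite: DupuyHilado2025, §3.3] -/
theorem qPilot_apply_of_not_mem {v : HeightOneSpectrum (𝓞 F)} (hv : v ∉ X.S) : X.qPilot v = 0 := by
  classical
  simp only [qPilot, FinDivisor.of, Finsupp.finsetSum_apply, Finsupp.single_apply, Finset.sum_ite_eq',
    if_neg hv]

end PilotData

/-! ## The inhabitant -/

section Inhabitant

variable {F₀ : Type} [Field F₀] [NumberField F₀] {K : Type} [Field K] [NumberField K] [Algebra F₀ K]

/-- `ord_v(1) = 0`. [cite: DupuyHilado2025, §3.4] -/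
theorem LocalFields.ordv_one {p : ℕ} [Fact p.Prime] (𝔽 : LocalFields F₀ p) (v : placesOver F₀ p) :
    𝔽.ordv (1 : (𝔽.k v)ˣ) = 0 := by
  simp [LocalFields.ordv]

/-- **The ideles of a genuine Θ-volume input exist.** Let `X` be pilot data over `F₀` and `σ` a section of the
finite places of `K` over those of `F₀`. Suppose that at every bad place `v ∈ S` the valuation `ord_v(q_v)/(2l)`
of `q̲_v = q_v^{1/2l}` is ATTAINED in the genuine completion `K_{v̲}` — i.e. lies in the value group
`(e_v/e_{v̲})·ℤ` of `ord_v` on `K_{v̲}^×` (`PlaceSection.exists_units_ordv_eq`); for a collection of initial Θ-data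
this holds because `q̲_v ∈ K_{v̲}` itself ([IUTchI] Ex. 3.2 (iv)). Then there is a `ThetaVolumeInput F₀ K` with
pilot data `X` and section `σ`: the Θ-idele at `(p, j, v)` is a unit of valuation `j²·ord_v(q_v)/(2l)` for `v ∈ S`
and `1` for `v ∉ S`, the `q`-idele likewise with `ord_v(q_v)/(2l)`. In particular abc-iut-S2's `−|log(Θ)|`
(`ThetaVolumeInput.negLogTheta`) and the claim-form `Cor312Of` are statements about `(X, σ)` and this one
divisibility datum — no `2l`-th ROOT of `q_v` is used. [cite: Mochizuki2012, IUTchI Ex. 3.2 (iv) p. 71] -/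
theorem ThetaVolumeInput.exists_of_ordq (X : PilotData F₀) (σ : PlaceSection F₀ K)
    (hq : ∀ v ∈ X.S, ∃ n : ℤ,
      (n : ℝ) * (ramIdx F₀ v : ℝ) / ((σ.lift v).asIdeal.ramificationIdx ℤ : ℝ) = (X.ordq v : ℝ) / (2 * X.l)) :
    ∃ I : ThetaVolumeInput F₀ K, I.X = X ∧ I.σ = σ := by
  classical
  -- units of the required valuations exist at every `(p, i, v)`
  have key : ∀ (c : ℝ) (p : ℕ) (hp : p.Prime) (v : placesOver F₀ p),
      (v.1 ∈ X.S → ∃ n : ℤ,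
        (n : ℝ) * (ramIdx F₀ v.1 : ℝ) / ((σ.lift v.1).asIdeal.ramificationIdx ℤ : ℝ) = c) →
      (v.1 ∉ X.S → c = 0) →
      ∃ a : (@LocalFields.k F₀ _ _ p ⟨hp⟩ (σ.localFieldFamily p hp) v)ˣ,
        @LocalFields.ordv F₀ _ _ p ⟨hp⟩ (σ.localFieldFamily p hp) v a = c := by
    intro c p hp v hmem hnot
    haveI : Fact p.Prime := ⟨hp⟩
    by_cases hv : v.1 ∈ X.S
    · obtain ⟨n, hn⟩ := hmem hv
      obtain ⟨a, ha⟩ := σ.exists_units_ordv_eq p v n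
      exact ⟨a, by rw [← hn]; exact ha⟩
    · exact ⟨1, by rw [hnot hv]; exact LocalFields.ordv_one _ v⟩
  have keyΘ : ∀ (p : ℕ) (hp : p.Prime) (i : Fin X.lstar) (v : placesOver F₀ p),
      ∃ a : (@LocalFields.k F₀ _ _ p ⟨hp⟩ (σ.localFieldFamily p hp) v)ˣ,
        @LocalFields.ordv F₀ _ _ p ⟨hp⟩ (σ.localFieldFamily p hp) v a = X.thetaPilot i v.1 := by
    intro p hp i v
    refine key _ p hp v (fun hv => ?_) (fun hv => X.thetaPilot_apply_of_not_mem i hv)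
    obtain ⟨n, hn⟩ := hq v.1 hv
    refine ⟨((i : ℕ) + 1 : ℤ) ^ 2 * n, ?_⟩
    rw [X.thetaPilot_apply_of_mem i hv, mul_div_assoc (((i : ℕ) + 1 : ℝ) ^ 2), ← hn]
    push_cast
    ring
  have keyq : ∀ (p : ℕ) (hp : p.Prime) (i : Fin X.lstar) (v : placesOver F₀ p),
      ∃ a : (@LocalFields.k F₀ _ _ p ⟨hp⟩ (σ.localFieldFamily p hp) v)ˣ,
        @LocalFields.ordv F₀ _ _ p ⟨hp⟩ (σ.localFieldFamily p hp) v a = X.qPilot v.1 := by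
    intro p hp i v
    refine key _ p hp v (fun hv => ?_) (fun hv => X.qPilot_apply_of_not_mem hv)
    obtain ⟨n, hn⟩ := hq v.1 hv
    exact ⟨n, by rw [X.qPilot_apply_of_mem hv, ← hn]⟩
  choose tΘ htΘ using keyΘ
  choose tq htq using keyq
  exact ⟨⟨X, σ, tΘ, htΘ, tq, htq⟩, rfl, rfl⟩

/-- The same, as nonemptiness of the type of genuine Θ-volume inputs. [cite: DupuyHilado2025, §3.9] -/
theorem ThetaVolumeInput.nonempty_of_ordq (X : PilotData F₀) (σ : PlaceSection F₀ K)
    (hq : ∀ v ∈ X.S, ∃ n : ℤ,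
      (n : ℝ) * (ramIdx F₀ v : ℝ) / ((σ.lift v).asIdeal.ramificationIdx ℤ : ℝ) = (X.ordq v : ℝ) / (2 * X.l)) :
    Nonempty (ThetaVolumeInput F₀ K) :=
  let ⟨I, _, _⟩ := ThetaVolumeInput.exists_of_ordq X σ hq
  ⟨I⟩

end Inhabitant

end Literature.IUT.LogVolume

end
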